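import Mathlib
import Literature.Analysis.FluidPDE.VectorCalculus
import HarnessLib

/-!
# Stagnation-point identities (R12′ of the ns-blowup rate audit): vorticity at a non-degenerate
# stagnation point of a steady flow

HONEST FRAMING (cell `ns-blowup`, seat `ns-blowup-instab` = the AUDIT seat, human ruling D-0035):
nothing here is a claim about Navier–Stokes blow-up. WHAT THIS IS NOT: not a statement about the
marginal tower N1*; it is the pointwise linear algebra behind `RATE-AUDIT.md` §6.6 (S1)/(S2):

* (S1) if the STEADY INVISCID vorticity balance `(U·∇)Ω = (Ω·∇)U` holds at a point `x₀` where
  `U x₀ = 0` and `DU(x₀)` is injective, then `Ω x₀ = 0` — the vorticity of a steady Euler flow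
  (or of any Beltrami field) vanishes at its non-degenerate stagnation points;
* (S2) if instead the STEADY VISCOUS balance `(U·∇)Ω = (Ω·∇)U + R` holds at `x₀` (`R = νΔΩ + curl f`
  evaluated at `x₀`) and `DU(x₀)` is invertible, then `Ω x₀ = -DU(x₀)⁻¹ R`, so
  `‖Ω x₀‖ ≤ ‖DU(x₀)⁻¹‖ · ‖R‖`; with `‖R‖ ≤ |ν| · C · ‖Ω x₀‖ / ℓ²` (core vorticity varying on scale
  `ℓ`) and `Ω x₀ ≠ 0` this forces `ℓ² ≤ ‖DU(x₀)⁻¹‖ · |ν| · C` — the BURGERS LOCK of the audit (§2.3,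
  R10) as an exact pointwise statement: a steady structure centred on a stagnation point lives at
  the viscous scale `(ν/σ)^{1/2}` or has zero core vorticity.

The convective derivative is the tree's `Literature.Analysis.FluidPDE.convect`
(`convect u v x = Dv(x)[u x]`, VectorCalculus.lean), so `(U·∇)Ω = (Ω·∇)U` at `x₀` reads
`convect U Ω x₀ = convect Ω U x₀`; for a time-independent `IsVorticitySolutionOn` (Vorticity.lean)
this is its `vorticity_eq` field with vanishing time derivative. The manifold form (S3: stable and
unstable manifolds of a steady Euler flow are vortex surfaces, Arnold 1966 / Kambe §8.8.1) is prose
only (RATE-AUDIT §6.6.2).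
-/

namespace Summit.NavierStokesRegularity.FluidComputer.StagnationPointIdentities

open Literature.Analysis.FluidPDE

section Inviscid

variable {E : Type*} [NormedAddCommGroup E] [InnerProductSpace ℝ E]

/-- **(S1) Vorticity vanishes at a non-degenerate stagnation point of a steady inviscid flow.**
If the steady inviscid vorticity balance `(U·∇)Ω (x₀) = (Ω·∇)U (x₀)` holds (the commutator
`[U, Ω](x₀) = DΩ(x₀)U(x₀) − DU(x₀)Ω(x₀)` vanishes), `U x₀ = 0`, and `DU(x₀)` is injective, then
`Ω x₀ = 0`. Proof: `DU(x₀) Ω(x₀) = DΩ(x₀) U(x₀) = DΩ(x₀) 0 = 0`. -/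
theorem eq_zero_of_steady_inviscid {U Ω : E → E} {x₀ : E}
    (hbal : convect U Ω x₀ = convect Ω U x₀) (hU : U x₀ = 0)
    (hinj : Function.Injective (fderiv ℝ U x₀)) : Ω x₀ = 0 := by
  have h : fderiv ℝ U x₀ (Ω x₀) = 0 := by
    rw [convect_apply, convect_apply, hU, map_zero] at hbal
    exact hbal.symm
  exact hinj (by rw [h, map_zero])

/-- The same with `DU(x₀)` given as a continuous linear equivalence (the hyperbolic case: no
zero eigenvalue). -/
theorem eq_zero_of_steady_inviscid' {U Ω : E → E} {x₀ : E} (L : E ≃L[ℝ] E)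
    (hL : (L : E →L[ℝ] E) = fderiv ℝ U x₀)
    (hbal : convect U Ω x₀ = convect Ω U x₀) (hU : U x₀ = 0) : Ω x₀ = 0 :=
  eq_zero_of_steady_inviscid hbal hU (by rw [← hL]; exact L.injective)

/-- Beltrami sanity check: for `Ω = λ • U` the balance hypothesis of (S1) holds at every point where
`U` is differentiable (both sides equal `λ • DU(x)[U x]`), so (S1) applies to every Beltrami field —
in particular to the (forced, viscous) ABC flow. -/
theorem beltrami_balance {U : E → E} {lam : ℝ} {x : E} (hU : DifferentiableAt ℝ U x) :
    convect U (fun y => lam • U y) x = convect (fun y => lam • U y) U x := by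
  rw [convect_apply, convect_apply, fderiv_fun_const_smul hU, map_smul]
  rfl

end Inviscid

section Viscous

variable {E : Type*} [NormedAddCommGroup E] [InnerProductSpace ℝ E]

/-- **(S2) Steady viscous balance at a stagnation point.** If `(U·∇)Ω (x₀) = (Ω·∇)U (x₀) + R`
(`R` = the viscous-plus-forcing remainder `νΔΩ(x₀) + curl f(x₀)`), `U x₀ = 0` and `DU(x₀) = L` is
invertible, then `Ω x₀ = -L⁻¹ R`. -/
theorem eq_neg_inv_of_steady_viscous {U Ω : E → E} {x₀ R : E} (L : E ≃L[ℝ] E)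
    (hL : (L : E →L[ℝ] E) = fderiv ℝ U x₀)
    (hbal : convect U Ω x₀ = convect Ω U x₀ + R) (hU : U x₀ = 0) :
    Ω x₀ = -(L.symm R) := by
  have h : L (Ω x₀) + R = 0 := by
    rw [convect_apply, convect_apply, hU, map_zero, ← hL] at hbal
    exact hbal.symm
  have h2 : L (Ω x₀) = -R := eq_neg_of_add_eq_zero_left h
  calc Ω x₀ = L.symm (L (Ω x₀)) := (L.symm_apply_apply _).symm
    _ = -(L.symm R) := by rw [h2, map_neg]

/-- **(S2) norm form — the Burgers lock, pointwise.** Under the hypotheses of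
`eq_neg_inv_of_steady_viscous`, `‖Ω x₀‖ ≤ ‖L⁻¹‖ · ‖R‖`: the core vorticity of a steady structure
centred on a stagnation point is controlled by the viscous (+ forcing) remainder alone. -/
theorem norm_le_of_steady_viscous {U Ω : E → E} {x₀ R : E} (L : E ≃L[ℝ] E)
    (hL : (L : E →L[ℝ] E) = fderiv ℝ U x₀)
    (hbal : convect U Ω x₀ = convect Ω U x₀ + R) (hU : U x₀ = 0) :
    ‖Ω x₀‖ ≤ ‖(L.symm : E →L[ℝ] E)‖ * ‖R‖ := by
  rw [eq_neg_inv_of_steady_viscous L hL hbal hU, norm_neg]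
  exact (L.symm : E →L[ℝ] E).le_opNorm R

/-- **Core-scale form of the lock.** If moreover the remainder is viscous-sized,
`‖R‖ ≤ |ν| · C · ‖Ω x₀‖ / ℓ²` (vorticity varying on scale `ℓ > 0` at `x₀`: `‖ΔΩ(x₀)‖ ≲ ‖Ω(x₀)‖/ℓ²`),
and the core vorticity is nonzero, then `ℓ² ≤ ‖L⁻¹‖ · |ν| · C`: the structure sits at the viscous
scale `(ν‖DU(x₀)⁻¹‖)^{1/2} ≍ (ν/σ_min)^{1/2}` (RATE-AUDIT §2.3 / §6.6.1; equality for the Burgers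
vortex, where `DU = diag(−σ/2, −σ/2, σ)`, `ΔΩ(0) = −(σ/ν)Ω(0)` for the Gaussian core `δ² = 4ν/σ`). -/
theorem core_scale_sq_le {U Ω : E → E} {x₀ R : E} (L : E ≃L[ℝ] E)
    (hL : (L : E →L[ℝ] E) = fderiv ℝ U x₀)
    (hbal : convect U Ω x₀ = convect Ω U x₀ + R) (hU : U x₀ = 0)
    {ν C ℓ : ℝ} (hℓ : 0 < ℓ)
    (hR : ‖R‖ ≤ |ν| * C * ‖Ω x₀‖ / ℓ ^ 2) (hΩ : Ω x₀ ≠ 0) :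
    ℓ ^ 2 ≤ ‖(L.symm : E →L[ℝ] E)‖ * |ν| * C := by
  have hn : 0 < ‖Ω x₀‖ := norm_pos_iff.mpr hΩ
  have hK : 0 ≤ ‖(L.symm : E →L[ℝ] E)‖ := norm_nonneg _
  have h1 := norm_le_of_steady_viscous L hL hbal hU
  have h2 : ‖Ω x₀‖ ≤ ‖(L.symm : E →L[ℝ] E)‖ * (|ν| * C * ‖Ω x₀‖ / ℓ ^ 2) :=
    h1.trans (mul_le_mul_of_nonneg_left hR hK)
  have hℓ2 : 0 < ℓ ^ 2 := by positivity
  -- multiply through by `ℓ²` and divide by `‖Ω x₀‖ > 0`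
  have h3 : ‖Ω x₀‖ * ℓ ^ 2 ≤ ‖(L.symm : E →L[ℝ] E)‖ * |ν| * C * ‖Ω x₀‖ := by
    have := mul_le_mul_of_nonneg_right h2 hℓ2.le
    calc ‖Ω x₀‖ * ℓ ^ 2 ≤ ‖(L.symm : E →L[ℝ] E)‖ * (|ν| * C * ‖Ω x₀‖ / ℓ ^ 2) * ℓ ^ 2 := this
      _ = ‖(L.symm : E →L[ℝ] E)‖ * |ν| * C * ‖Ω x₀‖ := by field_simp
  by_contra hlt
  have hlt' : ‖(L.symm : E →L[ℝ] E)‖ * |ν| * C < ℓ ^ 2 := not_le.mp hlt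
  have : ‖(L.symm : E →L[ℝ] E)‖ * |ν| * C * ‖Ω x₀‖ < ℓ ^ 2 * ‖Ω x₀‖ :=
    mul_lt_mul_of_pos_right hlt' hn
  linarith [mul_comm (ℓ ^ 2) ‖Ω x₀‖]

/-- Inviscid limit of (S2): with zero remainder the lock degenerates to (S1), `Ω x₀ = 0`. -/
theorem eq_zero_of_remainder_zero {U Ω : E → E} {x₀ : E} (L : E ≃L[ℝ] E)
    (hL : (L : E →L[ℝ] E) = fderiv ℝ U x₀)
    (hbal : convect U Ω x₀ = convect Ω U x₀ + 0) (hU : U x₀ = 0) : Ω x₀ = 0 := by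
  rw [eq_neg_inv_of_steady_viscous L hL hbal hU, map_zero, neg_zero]

end Viscous

end Summit.NavierStokesRegularity.FluidComputer.StagnationPointIdentities
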